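import Mathlib
import Literature.Analysis.FluidPDE.BallRadialMoments
import Summits.NavierStokesRegularity.NavierStokesRegularity.Theorems.EulerZoomLiouvillePowerGaugeEulerLiouvilleBallTentWeights
import Summits.NavierStokesRegularity.NavierStokesRegularity.Theorems.EulerZoomLiouvillePowerGaugeEulerLiouvilleSphereMeanValue
import Summits.NavierStokesRegularity.NavierStokesRegularity.Theorems.EulerZoomLiouvillePowerGaugeEulerLiouvilleRadialVirial
import HarnessLib

/-!
# R49 plate t52-TB, part 1: ball moments for the transport mean-value formula
# (nsreg-p2 ROUND-49 «EVERY BALL BREATHES», towards `NsregP2.R49.TransportMeanValueFormula`; seat ns-sfl-p1 g8,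
# `--supports stmt-NavierStokesRegularity-19832 --as helper`)

The `W`-form of the mean-value formula (`W = γ(y − c) + V`, `Π = P − ½γ(1−γ)‖y − c‖²`) is the `V`-form plus exact ball moments.
This file supplies the moments about an arbitrary centre `x₀` (`z = y − x₀`, `0 < δ`):
* `integral_ball_norm_mul_inner_eq_zero` — `∫_{B_δ(x₀)} ‖z‖·⟪U, z⟫ = 0` for `U ∈ C¹` divergence free (the radially weighted first
  moment; tested against the `C¹_c` radial weights `√|s|·χ_k(√|s|)` of `…BallTentWeights` via ns-ezl-w2 g5's `exists_radial_test` +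
  `integral_inner_gradient_eq_zero`, then dominated convergence — companion of ezl-w2's `integral_ball_inner_sub_eq_zero`);
* `integral_ball_norm_sub_pow` — `∫_{B_δ(x₀)} ‖z‖ⁿ = 4πδⁿ⁺³/(n+3)` (polar coordinates, `integral_ball_radial_fin_three`), with the
  named cases `n = 0, 1, 3` (`integral_ball_one_eq`, `integral_ball_norm_sub_eq`, `integral_ball_norm_sub_pow_three`; `n = 2` is
  ezl-w2's `integral_ball_norm_sub_sq`).

HONEST FRAMING: instrument lemmas of ROUND-49 (class-free); nothing about the crux E (19832 OPEN) or NS regularity is proved here.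
[nsreg-p2 R49 §1.2; folklore]
-/

noncomputable section

set_option linter.dupNamespace false

open MeasureTheory Set Filter Topology Metric Function
open scoped RealInnerProductSpace Topology

namespace Summit.NavierStokesRegularity.NavierStokesRegularity.Theorems.PowerGaugeEulerLiouville

open Literature.Analysis Literature.Analysis.FluidPDE

namespace ClassicalProfile

/-! ## The radially weighted first moment of a divergence-free field vanishes -/

/-- The weights `s ↦ √|s|·χ_k(√|s|)` are `C¹` (they vanish identically near `s = 0`). [folklore] -/
theorem contDiff_sqrtCutoff (k : ℕ) (δ : ℝ) :
    ContDiff ℝ 1 fun s : ℝ => Real.sqrt |s| *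
      (Real.smoothTransition (((k : ℝ) + 1) * Real.sqrt |s| - 1) * Real.smoothTransition (((k : ℝ) + 1) * (δ - Real.sqrt |s|))) := by
  have hχ := contDiff_tentCutoff k δ (n := 1)
  have hN : 0 < (1 / ((k : ℝ) + 1)) ^ 2 := by positivity
  refine contDiff_iff_contDiffAt.2 fun s => ?_
  by_cases hs : |s| < (1 / ((k : ℝ) + 1)) ^ 2
  · -- locally zero
    have hopen : IsOpen {s' : ℝ | |s'| < (1 / ((k : ℝ) + 1)) ^ 2} := isOpen_lt continuous_abs continuous_const
    have hev : (fun s' : ℝ => Real.sqrt |s'| *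
        (Real.smoothTransition (((k : ℝ) + 1) * Real.sqrt |s'| - 1) *
          Real.smoothTransition (((k : ℝ) + 1) * (δ - Real.sqrt |s'|)))) =ᶠ[𝓝 s] fun _ => 0 := by
      refine Filter.eventually_of_mem (hopen.mem_nhds hs) fun s' hs' => ?_
      have hle : Real.sqrt |s'| ≤ 1 / ((k : ℝ) + 1) := by
        have hN' : 0 ≤ 1 / ((k : ℝ) + 1) := by positivity
        rw [← Real.sqrt_sq hN']
        exact Real.sqrt_le_sqrt (le_of_lt hs')
      simp only [tentCutoff_eq_zero_of_le_inv k δ hle, mul_zero]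
    exact contDiffAt_const.congr_of_eventuallyEq hev
  · have hs0 : s ≠ 0 := by
      intro h; rw [h, abs_zero] at hs; exact hs hN
    rcases lt_or_gt_of_ne hs0 with hneg | hpos
    · have hev : (fun s' : ℝ => Real.sqrt |s'| *
          (Real.smoothTransition (((k : ℝ) + 1) * Real.sqrt |s'| - 1) *
            Real.smoothTransition (((k : ℝ) + 1) * (δ - Real.sqrt |s'|)))) =ᶠ[𝓝 s]
          fun s' => Real.sqrt (-s') *
            (Real.smoothTransition (((k : ℝ) + 1) * Real.sqrt (-s') - 1) *
              Real.smoothTransition (((k : ℝ) + 1) * (δ - Real.sqrt (-s')))) :=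
        Filter.eventually_of_mem (Iio_mem_nhds hneg) fun s' (hs' : s' < 0) => by simp only [abs_of_neg hs']
      refine ContDiffAt.congr_of_eventuallyEq ?_ hev
      have hsq : ContDiffAt ℝ 1 (fun s' : ℝ => Real.sqrt (-s')) s :=
        (Real.contDiffAt_sqrt (neg_ne_zero.2 hs0)).comp s contDiffAt_id.neg
      exact hsq.mul (hχ.contDiffAt.comp s hsq)
    · have hev : (fun s' : ℝ => Real.sqrt |s'| *
          (Real.smoothTransition (((k : ℝ) + 1) * Real.sqrt |s'| - 1) *
            Real.smoothTransition (((k : ℝ) + 1) * (δ - Real.sqrt |s'|)))) =ᶠ[𝓝 s]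
          fun s' => Real.sqrt s' *
            (Real.smoothTransition (((k : ℝ) + 1) * Real.sqrt s' - 1) *
              Real.smoothTransition (((k : ℝ) + 1) * (δ - Real.sqrt s'))) :=
        Filter.eventually_of_mem (Ioi_mem_nhds hpos) fun s' (hs' : 0 < s') => by simp only [abs_of_pos hs']
      refine ContDiffAt.congr_of_eventuallyEq ?_ hev
      have hsq : ContDiffAt ℝ 1 (fun s' : ℝ => Real.sqrt s') s := Real.contDiffAt_sqrt hs0
      exact hsq.mul (hχ.contDiffAt.comp s hsq)

/-- The weights `s ↦ √|s|·χ_k(√|s|)` have compact support (in `[−δ², δ²]`). [folklore] -/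
theorem hasCompactSupport_sqrtCutoff (k : ℕ) (δ : ℝ) :
    HasCompactSupport fun s : ℝ => Real.sqrt |s| *
      (Real.smoothTransition (((k : ℝ) + 1) * Real.sqrt |s| - 1) * Real.smoothTransition (((k : ℝ) + 1) * (δ - Real.sqrt |s|))) := by
  refine HasCompactSupport.intro (isCompact_Icc (a := -(δ ^ 2)) (b := δ ^ 2)) fun s hs => ?_
  have hs' : δ ^ 2 ≤ |s| := by
    simp only [mem_Icc, not_and_or, not_le] at hs
    rcases hs with h | h
    · have : s < 0 := by nlinarith [sq_nonneg δ]
      rw [abs_of_neg this]; linarith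
    · exact (le_abs_self s).trans' h.le
  have hδ : δ ≤ Real.sqrt |s| := by
    rcases le_or_gt 0 δ with hδ | hδ
    · calc δ = Real.sqrt (δ ^ 2) := (Real.sqrt_sq hδ).symm
        _ ≤ Real.sqrt |s| := Real.sqrt_le_sqrt hs'
    · exact hδ.le.trans (Real.sqrt_nonneg _)
  rw [tentCutoff_eq_zero_of_le k hδ, mul_zero]

/-- **The radially weighted first moment vanishes**: for `U ∈ C¹` divergence free, every centre `x₀` and `δ > 0`,
`∫_{B_δ(x₀)} ‖y − x₀‖·⟪U y, y − x₀⟫ dy = 0` (`⟪U, ‖z‖z⟫ = ⟪U, ∇(‖z‖³/3)⟫`; the sharp ball is reached by dominated convergence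
along the `C¹_c` weights `‖z‖χ_k(‖z‖)`; any real `δ`). [folklore] -/
theorem integral_ball_norm_mul_inner_eq_zero {U : EuclideanSpace ℝ (Fin 3) → EuclideanSpace ℝ (Fin 3)} (hU : ContDiff ℝ 1 U)
    (hdiv : VectorCalculus.IsDivFree U) (x₀ : EuclideanSpace ℝ (Fin 3)) (δ : ℝ) :
    ∫ y in ball x₀ δ, ‖y - x₀‖ * ⟪U y, y - x₀⟫ = 0 := by
  set χ : ℕ → ℝ → ℝ := fun k t =>
    Real.smoothTransition (((k : ℝ) + 1) * t - 1) * Real.smoothTransition (((k : ℝ) + 1) * (δ - t)) with hχ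
  -- each cutoff integral vanishes
  have hzero : ∀ k : ℕ, ∫ y, ‖y - x₀‖ * χ k ‖y - x₀‖ * ⟪U y, y - x₀⟫ = 0 := by
    intro k
    obtain ⟨X, hX, hXc, hgrad⟩ :=
      exists_radial_test (contDiff_sqrtCutoff k δ) (hasCompactSupport_sqrtCutoff k δ) x₀
    have h := integral_inner_gradient_eq_zero hU hdiv (hX.of_le (by norm_cast)) hXc
    refine (integral_congr_ae (ae_of_all _ fun y => ?_)).trans h
    show ‖y - x₀‖ * χ k ‖y - x₀‖ * ⟪U y, y - x₀⟫ = ⟪U y, gradient X y⟫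
    rw [(hgrad y).gradient, real_inner_smul_right, abs_of_nonneg (sq_nonneg _), Real.sqrt_sq (norm_nonneg _)]
  -- dominated convergence to the sharp ball
  have hcn : Continuous fun y : EuclideanSpace ℝ (Fin 3) => ‖y - x₀‖ := continuous_norm.comp (continuous_sub_right x₀)
  have hci : Continuous fun y : EuclideanSpace ℝ (Fin 3) => ⟪U y, y - x₀⟫ :=
    hU.continuous.inner (continuous_id.sub continuous_const)
  have hmeas : ∀ k, AEStronglyMeasurable (fun y => ‖y - x₀‖ * χ k ‖y - x₀‖ * ⟪U y, y - x₀⟫) volume := fun k =>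
    ((hcn.mul ((continuous_tentCutoff k δ).comp hcn)).mul hci).aestronglyMeasurable
  have hbound : ∀ k y, ‖‖y - x₀‖ * χ k ‖y - x₀‖ * ⟪U y, y - x₀⟫‖ ≤
      (closedBall x₀ δ).indicator (fun y => ‖y - x₀‖ * |⟪U y, y - x₀⟫|) y := by
    intro k y
    have hχI := tentCutoff_mem_Icc k δ ‖y - x₀‖
    by_cases hy : ‖y - x₀‖ ≤ δ
    · have hmem : y ∈ closedBall x₀ δ := by rwa [mem_closedBall, dist_eq_norm]
      rw [indicator_of_mem hmem, Real.norm_eq_abs, abs_mul, abs_mul, abs_of_nonneg (norm_nonneg _),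
        abs_of_nonneg hχI.1]
      calc ‖y - x₀‖ * χ k ‖y - x₀‖ * |⟪U y, y - x₀⟫| ≤ ‖y - x₀‖ * 1 * |⟪U y, y - x₀⟫| := by
            gcongr; exact hχI.2
        _ = ‖y - x₀‖ * |⟪U y, y - x₀⟫| := by ring
    · have hnot : y ∉ closedBall x₀ δ := by rw [mem_closedBall, dist_eq_norm]; exact hy
      rw [indicator_of_notMem hnot]
      simp [hχ, tentCutoff_eq_zero_of_le k (lt_of_not_ge hy).le]
  have hint : Integrable ((closedBall x₀ δ).indicator fun y => ‖y - x₀‖ * |⟪U y, y - x₀⟫|) volume :=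
    IntegrableOn.integrable_indicator
      ((hcn.mul hci.abs).continuousOn.integrableOn_compact (isCompact_closedBall x₀ δ)) measurableSet_closedBall
  have hlim : ∀ y, Tendsto (fun k => ‖y - x₀‖ * χ k ‖y - x₀‖ * ⟪U y, y - x₀⟫) atTop
      (𝓝 ((ball x₀ δ).indicator (fun y => ‖y - x₀‖ * ⟪U y, y - x₀⟫) y)) := by
    intro y
    by_cases hy : ‖y - x₀‖ < δ
    · have hmem : y ∈ ball x₀ δ := by rwa [mem_ball, dist_eq_norm]
      rw [indicator_of_mem hmem]
      by_cases hz : y - x₀ = 0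
      · simp only [hz, norm_zero, zero_mul]
        exact tendsto_const_nhds
      · have h := ((tendsto_tentCutoff (norm_pos_iff.2 hz) hy).const_mul ‖y - x₀‖).mul_const ⟪U y, y - x₀⟫
        rw [mul_one] at h
        exact h
    · have hnot : y ∉ ball x₀ δ := by rw [mem_ball, dist_eq_norm]; exact hy
      rw [indicator_of_notMem hnot]
      have e : (fun k => ‖y - x₀‖ * χ k ‖y - x₀‖ * ⟪U y, y - x₀⟫) = fun _ => 0 := by
        funext k; simp [hχ, tentCutoff_eq_zero_of_le k (le_of_not_gt hy)]
      rw [e]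
      exact tendsto_const_nhds
  have hDCT := tendsto_integral_of_dominated_convergence _ hmeas hint
    (fun k => Eventually.of_forall (hbound k)) (Eventually.of_forall hlim)
  simp only [hzero] at hDCT
  have h0 := tendsto_nhds_unique hDCT tendsto_const_nhds
  rwa [integral_indicator measurableSet_ball] at h0

/-! ## Radial moments of balls about `x₀` -/

/-- `∫_{B_δ(x₀)} ‖y − x₀‖ⁿ dy = 4π δⁿ⁺³/(n+3)` (`δ ≥ 0`). [folklore] -/
theorem integral_ball_norm_sub_pow (x₀ : EuclideanSpace ℝ (Fin 3)) {δ : ℝ} (hδ : 0 ≤ δ) (n : ℕ) :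
    ∫ y in ball x₀ δ, ‖y - x₀‖ ^ n = 4 * Real.pi * δ ^ (n + 3) / (n + 3) := by
  rw [setIntegral_ball_eq_setIntegral_ball_add (fun y => ‖y - x₀‖ ^ n) x₀ δ]
  simp only [add_sub_cancel_right]
  rw [integral_ball_radial_fin_three (fun r => r ^ n) hδ]
  have h : ∫ r in (0 : ℝ)..δ, r ^ 2 * r ^ n = δ ^ (n + 3) / (n + 3) := by
    have e : (fun r : ℝ => r ^ 2 * r ^ n) = fun r => r ^ (n + 2) := funext fun r => by ring
    rw [e, integral_pow, zero_pow (by omega : n + 2 + 1 ≠ 0), sub_zero]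
    push_cast
    ring_nf
  rw [h]
  ring

/-- `|B_δ(x₀)|` as an integral: `∫_{B_δ(x₀)} 1 = 4πδ³/3`. [folklore] -/
theorem integral_ball_one_eq (x₀ : EuclideanSpace ℝ (Fin 3)) {δ : ℝ} (hδ : 0 ≤ δ) :
    ∫ _y in ball x₀ δ, (1 : ℝ) = 4 * Real.pi * δ ^ 3 / 3 := by
  have h := integral_ball_norm_sub_pow x₀ hδ 0
  simp only [pow_zero, zero_add, Nat.cast_zero] at h
  rw [h]

/-- `∫_{B_δ(x₀)} ‖y − x₀‖ = πδ⁴`. [folklore] -/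
theorem integral_ball_norm_sub_eq (x₀ : EuclideanSpace ℝ (Fin 3)) {δ : ℝ} (hδ : 0 ≤ δ) :
    ∫ y in ball x₀ δ, ‖y - x₀‖ = Real.pi * δ ^ 4 := by
  have h := integral_ball_norm_sub_pow x₀ hδ 1
  simp only [pow_one, Nat.cast_one] at h
  rw [h]
  ring

/-- `∫_{B_δ(x₀)} ‖y − x₀‖³ = 2πδ⁶/3`. [folklore] -/
theorem integral_ball_norm_sub_pow_three (x₀ : EuclideanSpace ℝ (Fin 3)) {δ : ℝ} (hδ : 0 ≤ δ) :
    ∫ y in ball x₀ δ, ‖y - x₀‖ ^ 3 = 2 * Real.pi * δ ^ 6 / 3 := by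
  have h := integral_ball_norm_sub_pow x₀ hδ 3
  simp only [Nat.cast_ofNat] at h
  rw [h]
  ring

end ClassicalProfile

end Summit.NavierStokesRegularity.NavierStokesRegularity.Theorems.PowerGaugeEulerLiouville

end
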